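import Summits.QuantumFields.YangMills.Theorems.BalabanUVNodesN16Eq42PermutationDefectAbelian
import Summits.QuantumFields.YangMills.Theorems.BalabanUVNodesN16Eq42PermutationDefectNonAbelian
import Summits.QuantumFields.BalabanUV.T4Continuum.Support.NE7BlockAverageContourGaugeAbelian
import HarnessLib

/-!
# YM-DAG node N16 (NE3), the located averaging pin (42) ↔ (0.4) — part 11: (42) IS EUCLIDEAN-COVARIANT UP TO AN EXPLICIT COARSE GAUGE TRANSFORMATION —
# EXACTLY at the linearised level and for abelian fields (the permutation «defect» of parts 1–5 is a coarse pure gauge; its `O(L³δ)` bound is the size of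
# that gauge function's coarse gradient); gauge-invariant coarse plaquettes of `(r_σW)‾` and `r_σ(W̄)` AGREE EXACTLY

Cell `pub-ymgap`, width seat `pub-ymgap-dag-n16-w3` (director-ym №197 ∕ HUMAN RULING D-0149), generation 5; part 11 of the W1b sequel (parts 8–10: the centring part
is a gauge).  `--kind proof --supports stmt-QuantumFields-20544 --as helper` (K3⁷; count-neutral; 0 def).  `bears_on: R4∕N16`.

THE POINT (a reading UPGRADE of parts 1–5, prompted by the tree's exact abelian gauge identity `NE7BlockAverageContourGaugeAbelian.bavg_expUnit_eq_gauge`: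
abelian (42) = coarse gauge transform by `exp ∘ treePot` of the straight average).  Part 1's exact identity `N16Eq42PermutationDefect.Xhat_permCfg_sub` writes
the relabelling defect of the LINEARISED exponent as `Σ_r L^{−d}•[D_r(q′) − D_r(q′ + L e_{σκ})]`, `D_r(p) = A(σ-tree word from p) − A(tree word from p)`, `q′ = r_σ q`.
Since `r_σ(q + L e_κ) = q′ + L e_{σκ}`, this IS `Ψ(q) − Ψ(q + L e_κ)` for the SITE FUNCTION `Ψ(y) := Σ_r L^{−d}•D_r(r_σ y)` — the coarse GRADIENT of an explicit
gauge function along the coarse bond `⟨q, q + Le_κ⟩`.  So: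
 * §1 ★★ `Xhat_permCfg_sub_eq_coarseGrad` (any normed ring, linearised): `X̂[r_σA](q,κ) − X̂[A](r_σq, σκ) = Ψ(q) − Ψ(q + L•e_κ)` EXACTLY — the relabelling
   defect of (42)'s first-order exponent IS A COARSE PURE GAUGE (no error term, no constant-curvature hypothesis); `Tside_permCfg_sub_eq_coarseGrad` (same for
   the contour average `T_c`);
 * §2 ★★ `bavg_permCfg_eq_coarseGauge` (commutative complete normed ℂ-algebra, `W = e^A`, loops in the ball of `log`):
   `(r_σW)‾(q,κ) = e^{Ψ(q)} · (r_σ W̄)(q,κ) · (e^{Ψ(q+L•e_κ)})⁻¹` EXACTLY — averaging the relabelled field IS relabelling the averaged field FOLLOWED BY THE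
   COARSE GAUGE TRANSFORMATION `e^{Ψ}` (tree shape `bavg_gaugeAct`: `u(c₋)·V̄_c·u(c₊)⁻¹`); ★ `cplaq_bavg_permCfg` — hence every coarse PLAQUETTE variable of
   `(r_σW)‾` equals that of `r_σ(W̄)` EXACTLY (tree `cplaq_conj`, commutative): at the gauge-invariant level (42) IS Euclidean-covariant on abelian fields;
 * §3 ★ `norm_Xavg_permCfg_sub_sub_coarseGrad_le` (any complete normed ℂ-algebra with `‖1‖ = 1`, `V_b = e^{A_b}`, `‖A_b‖ ≤ a` within `ℓ = 2dL + 2L` of `r_σq`,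
   `e^{ℓa} − 1 ≤ ½`): the NON-ABELIAN exponents satisfy `‖(X[r_σV](q,κ) − X[V](r_σq,σκ)) − (Ψ(q) − Ψ(q+L•e_κ))‖ ≤ 2ρ₂(ℓ,a)` — covariant up to the coarse gauge
   to SECOND order, with NO curvature hypothesis (part 3's `norm_Xavg_sub_Xhat_le` on both sides of §1; contrast part 3's `norm_Xavg_permCfg_sub_le`, which needs
   Lipschitz flux because it does not subtract the gauge term).

READING FOR N16 (honest; supersedes the wording of `W3-PIN-ANATOMY.md` v2 for the permutation part).  g0's `B7Eq42NotEuclideanSymmetric.not_permEquivariant_bavg`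
stands (the bond variables differ — by exactly the gauge factor above, `≠ 1` at the witness); parts 1–5's `O(d²L³δ)` (+ `2ρ₂`) bound the SIZE of `Ψ(q) − Ψ(q+L•e_κ)`.
The refined anatomy: (42) ↔ (0.4) = [axis permutations: an EXACT coarse gauge (linearised∕abelian); non-abelian to second order `2ρ₂`] + [block centring: an EXACT
coarse gauge ∘ a TRANSLATION of the straight-average field by the fine offset `s`, the latter a gauge up to the contracted curvature `ι_s F` — parts 6–10,
`O(d²L³δ)`].  The ONLY non-gauge first-order content of the pin is the translation term.  Nothing here is about minimisers or Bałaban's estimates.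

HONEST FRAMING.  [folklore] bookkeeping BY NAME over part 1 (`Xhat_permCfg_sub`, `Tside_permCfg_sub`, `loop_small_of_flux`, `flux_bound_permCfg`), part 2
(`permCfg_expUnit`), part 3 (`norm_Xavg_sub_Xhat_le`, `expRep_permCfg`), `AbelianBlockAverage.bavg_expUnit`, `NE7BlockAverageContourGaugeAbelian` (`expUnit_add`, `expUnit_sub`), `B12Average012Permutation`
(`permSite_add`, `permSite_smul`, `permSite_e`), `B7Prop1Explicit.cplaq_conj`; 0 `def`, 0 `sorry`; no printed sentence is a hypothesis; nothing of [Balaban1985Averaging]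
∕ [Balaban1987RG1] asserted beyond what the tree proves; no minimiser; `stub_h7` ∕ the K3⁷ stubs NOT touched; N16 ∕ NE3 NOT discharged; count-neutral (typed 28∕28 ·
discharged 5∕27 work-bound, A 5∕28 — unmoved).  One finite four-torus programme at fixed `ε` — the Yang–Mills mass gap (Clay) is NOT proved by any of this; R4
closes the conditional finite-𝕋⁴ rung `BalabanLadder.UV` only; nothing continuum ∕ ℝ⁴ ∕ OS.
-/

set_option autoImplicit false

open scoped BigOperators
open NormedSpace Finset

namespace Summit.QuantumFields.YangMills.BalabanUVNodes.N16Eq42PermutationCovarianceUpToGauge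

open Literature.MathematicalPhysics.QuantumFieldTheory.Balaban1983to89
open B7Prop1Explicit
open B12Average012Permutation (permSite permCfg permCfg_apply permSite_add permSite_smul permSite_e)
open B12ContourAverage253 (permWord)
open Summit.QuantumFields.YangMills.BalabanUVNodes.N16Eq42PermutationDefect
  (Xhat_permCfg_sub Tside_permCfg_sub loop_small_of_flux flux_bound_permCfg)
open Summit.QuantumFields.YangMills.BalabanUVNodes.N16Eq42PermutationDefectAbelian (permCfg_expUnit)
open Summit.QuantumFields.YangMills.BalabanUVNodes.N16Eq42PermutationDefectNonAbelian (norm_Xavg_sub_Xhat_le expRep_permCfg)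
open Summit.QuantumFields.BalabanUV.T4Continuum.AbelianBlockAverage (bavg_expUnit)
open Summit.QuantumFields.BalabanUV.T4Continuum.NE7BlockAverageContourGaugeAbelian (expUnit_add expUnit_sub)

noncomputable section

variable {d : ℕ}

/-! ## §1 Linearised: the relabelling defect is the coarse gradient of an explicit site function -/

section Linear

variable {𝔸 : Type*} [NormedRing 𝔸] [NormedAlgebra ℂ 𝔸]

/-- Relabelling a coarse step: `r_σ(q + L•e_κ) = r_σ q + L•e_{σκ}`. [folklore] -/
theorem permSite_add_coarseStep (σ : Equiv.Perm (Fin d)) (L : ℕ) (q : Site d) (κ : Fin d) :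
    permSite σ (q + (L : ℤ) • e κ) = permSite σ q + (L : ℤ) • e (σ κ) := by
  rw [permSite_add, permSite_smul, permSite_e]

/-- **★★ THE RELABELLING DEFECT OF (42)'s LINEARISED EXPONENT IS A COARSE PURE GAUGE, EXACTLY.**  For every bond field `A` with values in a normed ring, every
axis permutation `σ`, every `L` and every bond `(q, κ)`:
`X̂[r_σA](q,κ) − X̂[A](r_σq, σκ) = Ψ(q) − Ψ(q + L•e_κ)`, `Ψ(y) = Σ_r L^{−d} • [A(σ-tree word of r from r_σy) − A(tree word of r from r_σy)]` (displayed) — the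
coarse gradient of the block mean of the «σ-tree minus tree» closed-loop circulations (part 1 `Xhat_permCfg_sub` + `r_σ(q + L•e_κ) = r_σq + L•e_{σκ}`).  No
constant-curvature or Lipschitz hypothesis. [folklore] -/
theorem Xhat_permCfg_sub_eq_coarseGrad (L : ℕ) (σ : Equiv.Perm (Fin d)) (A : Site d → Fin d → 𝔸) (q : Site d) (κ : Fin d) :
    Xhat L (permCfg σ A) q κ - Xhat L A (permSite σ q) (σ κ)
      = (∑ r : Fin d → Fin L, (((L : ℝ) ^ d)⁻¹) •
            (asum A (permSite σ q) (permWord σ (boxVec L r)) - asum A (permSite σ q) (treeWord (boxVec L r))))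
        - ∑ r : Fin d → Fin L, (((L : ℝ) ^ d)⁻¹) •
            (asum A (permSite σ (q + (L : ℤ) • e κ)) (permWord σ (boxVec L r))
              - asum A (permSite σ (q + (L : ℤ) • e κ)) (treeWord (boxVec L r))) := by
  rw [Xhat_permCfg_sub, permSite_add_coarseStep, ← Finset.sum_sub_distrib]
  refine Finset.sum_congr rfl fun r _ => ?_
  rw [smul_sub]

/-- The same for the linear contour average `T_c = X̂_c + A(Γ_c)` (the straight segment relabels to the straight segment). [folklore] -/
theorem Tside_permCfg_sub_eq_coarseGrad (L : ℕ) (hL : 1 ≤ L) (σ : Equiv.Perm (Fin d)) (A : Site d → Fin d → 𝔸) (q : Site d)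
    (κ : Fin d) :
    Tside L (permCfg σ A) q κ - Tside L A (permSite σ q) (σ κ)
      = (∑ r : Fin d → Fin L, (((L : ℝ) ^ d)⁻¹) •
            (asum A (permSite σ q) (permWord σ (boxVec L r)) - asum A (permSite σ q) (treeWord (boxVec L r))))
        - ∑ r : Fin d → Fin L, (((L : ℝ) ^ d)⁻¹) •
            (asum A (permSite σ (q + (L : ℤ) • e κ)) (permWord σ (boxVec L r))
              - asum A (permSite σ (q + (L : ℤ) • e κ)) (treeWord (boxVec L r))) := by
  rw [Tside_permCfg_sub L hL, Xhat_permCfg_sub_eq_coarseGrad]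

end Linear

/-! ## §2 Abelian fields: averaging the relabelled field = relabelling the average, then an explicit coarse gauge transformation -/

section Comm

variable {𝔸 : Type*} [NormedCommRing 𝔸] [NormedAlgebra ℂ 𝔸] [CompleteSpace 𝔸]

/-- **★★ (42) IS RELABELLING-COVARIANT UP TO AN EXPLICIT COARSE GAUGE TRANSFORMATION, EXACTLY, ON ABELIAN FIELDS.**  In a commutative complete normed
ℂ-algebra let `W = e^A` bondwise with a flux bound `‖A(∂p)_p(m, σκ)‖ ≤ φ`, `d·L²·φ < log 2` (the loop variables of both averages lie in the ball of the
logarithm, part 1 `loop_small_of_flux`).  Then, with `Ψ` the site function of §1,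
`(r_σW)‾(q,κ) = e^{Ψ(q)} · (r_σ W̄)(q,κ) · (e^{Ψ(q + L•e_κ)})⁻¹` — the shape `u(c₋)·V̄_c·u(c₊)⁻¹` of a COARSE gauge transformation (tree `bavg_gaugeAct`, (45)).
Contrast: g0's `B7Eq42NotEuclideanSymmetric.not_permEquivariant_bavg` — the bond variables themselves differ (by this factor). [folklore] -/
theorem bavg_permCfg_eq_coarseGauge (L : ℕ) (hL : 1 ≤ L) (σ : Equiv.Perm (Fin d)) (A : Site d → Fin d → 𝔸) (q : Site d) (κ : Fin d)
    {φ : ℝ} (hφ0 : 0 ≤ φ) (hφ : ∀ (p : Site d) (m : Fin d), ‖asum A p (plaqWord m (σ κ))‖ ≤ φ) (hφL : d * (L : ℝ) ^ 2 * φ < Real.log 2) :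
    bavg L (permCfg σ fun y μ => expUnit (A y μ)) q κ
      = expUnit (∑ r : Fin d → Fin L, (((L : ℝ) ^ d)⁻¹) •
            (asum A (permSite σ q) (permWord σ (boxVec L r)) - asum A (permSite σ q) (treeWord (boxVec L r))))
        * permCfg σ (bavg L fun y μ => expUnit (A y μ)) q κ
        * (expUnit (∑ r : Fin d → Fin L, (((L : ℝ) ^ d)⁻¹) •
            (asum A (permSite σ (q + (L : ℤ) • e κ)) (permWord σ (boxVec L r))
              - asum A (permSite σ (q + (L : ℤ) • e κ)) (treeWord (boxVec L r)))))⁻¹ := by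
  rw [permCfg_expUnit, permCfg_apply,
    bavg_expUnit L hL (permCfg σ A) q κ (loop_small_of_flux L (permCfg σ A) q κ hφ0 (flux_bound_permCfg σ A κ hφ) hφL),
    bavg_expUnit L hL A (permSite σ q) (σ κ) (loop_small_of_flux L A _ _ hφ0 hφ hφL), ← expUnit_add, ← expUnit_sub]
  congr 1
  have h := Tside_permCfg_sub_eq_coarseGrad L hL σ A q κ
  -- `T[r_σA] = Ψ(q) + T[A](q′,σκ) − Ψ(q+L•e_κ)`
  rw [sub_eq_iff_eq_add] at h
  rw [h]
  abel

/-- **★ HENCE THE COARSE PLAQUETTE VARIABLES AGREE EXACTLY**: for every coarse plaquette `p′` (corner `z`, directions `μ, ν`),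
`[(r_σW)‾](∂p′) = [r_σ(W̄)](∂p′)` — at the gauge-invariant level (42) IS Euclidean-covariant on abelian fields (tree `cplaq_conj`; commutative conjugation is
trivial).  The flux bound is taken in every plane `(m, k)` so that all four bonds of `p′` are covered. [folklore] -/
theorem cplaq_bavg_permCfg (L : ℕ) (hL : 1 ≤ L) (σ : Equiv.Perm (Fin d)) (A : Site d → Fin d → 𝔸) (z : Site d) (μ ν : Fin d)
    {φ : ℝ} (hφ0 : 0 ≤ φ) (hφ : ∀ (p : Site d) (m k : Fin d), ‖asum A p (plaqWord m k)‖ ≤ φ) (hφL : d * (L : ℝ) ^ 2 * φ < Real.log 2) :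
    cplaq L (bavg L (permCfg σ fun y m => expUnit (A y m))) z μ ν
      = cplaq L (permCfg σ (bavg L fun y m => expUnit (A y m))) z μ ν := by
  set u : Site d → 𝔸ˣ := fun y => expUnit (∑ r : Fin d → Fin L, (((L : ℝ) ^ d)⁻¹) •
    (asum A (permSite σ y) (permWord σ (boxVec L r)) - asum A (permSite σ y) (treeWord (boxVec L r)))) with hu
  have hb : ∀ (y : Site d) (k : Fin d), bavg L (permCfg σ fun y m => expUnit (A y m)) y k
      = u y * permCfg σ (bavg L fun y m => expUnit (A y m)) y k * (u (y + (L : ℤ) • e k))⁻¹ :=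
    fun y k => bavg_permCfg_eq_coarseGauge L hL σ A y k hφ0 (fun p m => hφ p m (σ k)) hφL
  rw [cplaq_conj L u (permCfg σ (bavg L fun y m => expUnit (A y m))) _ z μ ν (hb z μ) (hb _ ν) (hb _ μ) (hb z ν),
    mul_inv_cancel_comm]

end Comm

/-! ## §3 Non-abelian: covariant up to the coarse gauge to second order, with no curvature hypothesis -/

section NonAbelian

variable {𝔸 : Type*} [NormedRing 𝔸] [NormOneClass 𝔸] [NormedAlgebra ℂ 𝔸] [CompleteSpace 𝔸]

omit [NormOneClass 𝔸] in
/-- **★ THE NON-ABELIAN EXPONENT OF (42) IS RELABELLING-COVARIANT UP TO THE COARSE GAUGE `Ψ`, TO SECOND ORDER**: for `V_b = e^{A_b}`, `‖A_b‖ ≤ a` on the bonds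
within `|·|₁`-distance `ℓ = 2dL + 2L` of `q′ = r_σq`, `e^{ℓa} − 1 ≤ ½`:
`‖(X[r_σV](q,κ) − X[V](r_σq, σκ)) − (Ψ(q) − Ψ(q + L•e_κ))‖ ≤ 2ρ₂(ℓ,a)`, `ρ₂(ℓ,a) = ρ(2(e^{ℓa} − 1)) + ρ(ℓa)` — §1's exact identity in the middle, part 3's
`norm_Xavg_sub_Xhat_le` on both sides; NO Lipschitz-flux hypothesis (contrast part 3's `norm_Xavg_permCfg_sub_le`). [folklore] -/
theorem norm_Xavg_permCfg_sub_sub_coarseGrad_le (L : ℕ) (hL : 1 ≤ L) (σ : Equiv.Perm (Fin d)) (V : Site d → Fin d → 𝔸ˣ)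
    (A : Site d → Fin d → 𝔸) (q : Site d) (κ : Fin d) {a : ℝ} (ha : 0 ≤ a)
    (hVA : ∀ (x : Site d) (μ : Fin d), l1 (x - permSite σ q) ≤ 2 * (d * L) + L + L →
      ((V x μ : 𝔸ˣ) : 𝔸) = exp (A x μ) ∧ ‖A x μ‖ ≤ a)
    (hsmall : Real.exp (((2 * (d * L) + L + L : ℕ) : ℝ) * a) - 1 ≤ 1 / 2) :
    ‖(Xavg L (permCfg σ V) q κ - Xavg L V (permSite σ q) (σ κ))
        - ((∑ r : Fin d → Fin L, (((L : ℝ) ^ d)⁻¹) •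
              (asum A (permSite σ q) (permWord σ (boxVec L r)) - asum A (permSite σ q) (treeWord (boxVec L r))))
          - ∑ r : Fin d → Fin L, (((L : ℝ) ^ d)⁻¹) •
              (asum A (permSite σ (q + (L : ℤ) • e κ)) (permWord σ (boxVec L r))
                - asum A (permSite σ (q + (L : ℤ) • e κ)) (treeWord (boxVec L r))))‖
      ≤ 2 * (expRem (2 * (Real.exp (((2 * (d * L) + L + L : ℕ) : ℝ) * a) - 1))
            + expRem (((2 * (d * L) + L + L : ℕ) : ℝ) * a)) := by
  have h1 := norm_Xavg_sub_Xhat_le L hL (permCfg σ V) (permCfg σ A) q κ ha (expRep_permCfg σ V A q _ hVA) hsmall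
  have h2 := norm_Xavg_sub_Xhat_le L hL V A (permSite σ q) (σ κ) ha hVA hsmall
  rw [← Xhat_permCfg_sub_eq_coarseGrad L σ A q κ]
  calc ‖(Xavg L (permCfg σ V) q κ - Xavg L V (permSite σ q) (σ κ))
          - (Xhat L (permCfg σ A) q κ - Xhat L A (permSite σ q) (σ κ))‖
      = ‖(Xavg L (permCfg σ V) q κ - Xhat L (permCfg σ A) q κ)
          - (Xavg L V (permSite σ q) (σ κ) - Xhat L A (permSite σ q) (σ κ))‖ := by congr 1; abel
    _ ≤ ‖Xavg L (permCfg σ V) q κ - Xhat L (permCfg σ A) q κ‖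
          + ‖Xavg L V (permSite σ q) (σ κ) - Xhat L A (permSite σ q) (σ κ)‖ := norm_sub_le _ _
    _ ≤ _ := by linarith

end NonAbelian

end

end Summit.QuantumFields.YangMills.BalabanUVNodes.N16Eq42PermutationCovarianceUpToGauge
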